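import Mathlib
import Literature.MeasureTheory.Integral.GaussGreenBetweenGraphs
import HarnessLib

/-!
# An H-polyhedron is vertically simple: its fibres along the last coordinate are intervals
# between a finite maximum and a finite minimum of affine functions

Topic `Literature/MeasureTheory/Integral`; namespace `Literature.MeasureTheory.Integral`.

Let `P = {(x, t) ∈ (ℝ × ℝ) × ℝ | ∀ j ∈ J, A j x + c j · t ≤ b j}` be a finite intersection of closed
half-spaces, written in coordinates adapted to the vertical direction (`A j : ℝ × ℝ → ℝ` any
functions of the horizontal variables — affine in the intended use).  If some constraint bounds
`t` from above (`c j > 0`) and some from below (`c j < 0`), then `P` is EXACTLY the region between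
two graphs over a base:
`P = {(x,t) | x ∈ D ∧ lo x ≤ t ≤ hi x}` with `hi x = min_{c j > 0} (b j − A j x)/c j`,
`lo x = max_{c j < 0} (b j − A j x)/c j`, `D = {x | (∀ j, c j = 0 → A j x ≤ b j) ∧ lo x ≤ hi x}`
(`setOf_hConstraints_eq_between_graphs`), with `lo`, `hi` continuous (hence measurable) when the
`A j` are (`continuous_hiGraph` / `continuous_loGraph`) and `D` measurable.  Combined with
`setIntegral_deriv_between_graphs` (this topic) this is the vertical component of the Gauss–Green
formula for convex polyhedra: `∫_P ∂_t g = ∫_D (g(x, hi x) − g(x, lo x)) dx`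
(`setIntegral_deriv_hPolyhedron`).  This is brick L2 of the facet-formula programme (crystal3d-full
eng MEMO-5); the decomposition of the graphs `hi`, `lo` into the facets is NOT done here.
-/

noncomputable section

namespace Literature.MeasureTheory.Integral

open _root_.MeasureTheory Set Finset

variable {ι : Type*}

/-- Upper graph: the minimum of the upper constraints `t ≤ (b j − A j x)/c j` (`c j > 0`). [cite: EvansGariepy2015, Thm 5.16 (Gauss–Green), vertically simple domains — plumbing] -/
theorem le_inf'_upper_iff {J : Finset ι} (A : ι → (ℝ × ℝ) → ℝ) (c b : ι → ℝ)
    (hJ : (J.filter fun j => 0 < c j).Nonempty) (x : ℝ × ℝ) (t : ℝ) :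
    t ≤ (J.filter fun j => 0 < c j).inf' hJ (fun j => (b j - A j x) / c j) ↔
      ∀ j ∈ J, 0 < c j → A j x + c j * t ≤ b j := by
  rw [Finset.le_inf'_iff]
  constructor
  · intro h j hj hc
    have := h j (Finset.mem_filter.2 ⟨hj, hc⟩)
    rw [le_div_iff₀ hc] at this
    linarith
  · intro h j hj
    rw [Finset.mem_filter] at hj
    rw [le_div_iff₀ hj.2]
    linarith [h j hj.1 hj.2]

/-- Lower graph: the maximum of the lower constraints `t ≥ (b j − A j x)/c j` (`c j < 0`). [cite: EvansGariepy2015, Thm 5.16 (Gauss–Green), vertically simple domains — plumbing] -/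
theorem sup'_lower_le_iff {J : Finset ι} (A : ι → (ℝ × ℝ) → ℝ) (c b : ι → ℝ)
    (hJ : (J.filter fun j => c j < 0).Nonempty) (x : ℝ × ℝ) (t : ℝ) :
    (J.filter fun j => c j < 0).sup' hJ (fun j => (b j - A j x) / c j) ≤ t ↔
      ∀ j ∈ J, c j < 0 → A j x + c j * t ≤ b j := by
  rw [Finset.sup'_le_iff]
  constructor
  · intro h j hj hc
    have := h j (Finset.mem_filter.2 ⟨hj, hc⟩)
    rw [div_le_iff_of_neg hc] at this
    linarith
  · intro h j hj
    rw [Finset.mem_filter] at hj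
    rw [div_le_iff_of_neg hj.2]
    linarith [h j hj.1 hj.2]

/-- **An H-polyhedron with vertical bounds in both directions is the region between two graphs.**
[cite: EvansGariepy2015, Thm 5.16 (Gauss–Green), vertically simple domains] -/
theorem setOf_hConstraints_eq_between_graphs {J : Finset ι} (A : ι → (ℝ × ℝ) → ℝ) (c b : ι → ℝ)
    (hup : (J.filter fun j => 0 < c j).Nonempty) (hlow : (J.filter fun j => c j < 0).Nonempty) :
    {p : (ℝ × ℝ) × ℝ | ∀ j ∈ J, A j p.1 + c j * p.2 ≤ b j} =
      {p : (ℝ × ℝ) × ℝ |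
        p.1 ∈ {x : ℝ × ℝ | (∀ j ∈ J, c j = 0 → A j x ≤ b j) ∧
            (J.filter fun j => c j < 0).sup' hlow (fun j => (b j - A j x) / c j) ≤
              (J.filter fun j => 0 < c j).inf' hup (fun j => (b j - A j x) / c j)} ∧
          (J.filter fun j => c j < 0).sup' hlow (fun j => (b j - A j p.1) / c j) ≤ p.2 ∧
          p.2 ≤ (J.filter fun j => 0 < c j).inf' hup (fun j => (b j - A j p.1) / c j)} := by
  ext ⟨x, t⟩
  simp only [mem_setOf_eq]
  rw [le_inf'_upper_iff A c b hup x t, sup'_lower_le_iff A c b hlow x t]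
  constructor
  · intro h
    have hu : ∀ j ∈ J, 0 < c j → A j x + c j * t ≤ b j := fun j hj _ => h j hj
    have hl : ∀ j ∈ J, c j < 0 → A j x + c j * t ≤ b j := fun j hj _ => h j hj
    refine ⟨⟨fun j hj hc => ?_, ?_⟩, hl, hu⟩
    · have := h j hj; rw [hc, zero_mul, add_zero] at this; exact this
    · exact ((sup'_lower_le_iff A c b hlow x t).2 hl).trans ((le_inf'_upper_iff A c b hup x t).2 hu)
  · rintro ⟨⟨h0, -⟩, hl, hu⟩ j hj
    rcases lt_trichotomy (c j) 0 with hc | hc | hc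
    · exact hl j hj hc
    · rw [hc, zero_mul, add_zero]; exact h0 j hj hc
    · exact hu j hj hc

/-- The upper graph is continuous when the constraints are. [cite: EvansGariepy2015, Thm 5.16 (Gauss–Green), vertically simple domains — plumbing] -/
theorem continuous_hiGraph {J : Finset ι} {A : ι → (ℝ × ℝ) → ℝ} (hA : ∀ j, Continuous (A j))
    (c b : ι → ℝ) (hup : (J.filter fun j => 0 < c j).Nonempty) :
    Continuous fun x : ℝ × ℝ =>
      (J.filter fun j => 0 < c j).inf' hup (fun j => (b j - A j x) / c j) := by
  refine Continuous.finset_inf'_apply hup fun j _ => ?_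
  exact ((continuous_const.sub (hA j)).div_const _)

/-- The lower graph is continuous when the constraints are. [cite: EvansGariepy2015, Thm 5.16 (Gauss–Green), vertically simple domains — plumbing] -/
theorem continuous_loGraph {J : Finset ι} {A : ι → (ℝ × ℝ) → ℝ} (hA : ∀ j, Continuous (A j))
    (c b : ι → ℝ) (hlow : (J.filter fun j => c j < 0).Nonempty) :
    Continuous fun x : ℝ × ℝ =>
      (J.filter fun j => c j < 0).sup' hlow (fun j => (b j - A j x) / c j) := by
  refine Continuous.finset_sup'_apply hlow fun j _ => ?_
  exact ((continuous_const.sub (hA j)).div_const _)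

/-- The base of an H-polyhedron (in vertical coordinates) is measurable. [cite: EvansGariepy2015, Thm 5.16 (Gauss–Green), vertically simple domains — plumbing] -/
theorem measurableSet_baseOfHConstraints {J : Finset ι} {A : ι → (ℝ × ℝ) → ℝ}
    (hA : ∀ j, Continuous (A j)) (c b : ι → ℝ) (hup : (J.filter fun j => 0 < c j).Nonempty)
    (hlow : (J.filter fun j => c j < 0).Nonempty) :
    MeasurableSet {x : ℝ × ℝ | (∀ j ∈ J, c j = 0 → A j x ≤ b j) ∧
      (J.filter fun j => c j < 0).sup' hlow (fun j => (b j - A j x) / c j) ≤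
        (J.filter fun j => 0 < c j).inf' hup (fun j => (b j - A j x) / c j)} := by
  have h1 : MeasurableSet {x : ℝ × ℝ | ∀ j ∈ J, c j = 0 → A j x ≤ b j} := by
    have : {x : ℝ × ℝ | ∀ j ∈ J, c j = 0 → A j x ≤ b j} =
        ⋂ j ∈ J, {x : ℝ × ℝ | c j = 0 → A j x ≤ b j} := by
      ext x; simp only [mem_setOf_eq, mem_iInter]
    rw [this]
    refine MeasurableSet.biInter (J.countable_toSet) fun j _ => ?_
    by_cases hc : c j = 0
    · have : {x : ℝ × ℝ | c j = 0 → A j x ≤ b j} = {x | A j x ≤ b j} := by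
        ext x; simp [hc]
      rw [this]; exact measurableSet_le (hA j).measurable measurable_const
    · have : {x : ℝ × ℝ | c j = 0 → A j x ≤ b j} = univ := by
        ext x; simp [hc]
      rw [this]; exact MeasurableSet.univ
  have h2 := measurableSet_le (continuous_loGraph hA c b hlow).measurable
    (continuous_hiGraph hA c b hup).measurable
  simpa only [setOf_and] using h1.inter h2

/-- **Gauss–Green, vertical component, for an H-polyhedron** (bounded above and below in the
vertical direction): `∫_P ∂_t g = ∫_D (g(x, hi x) − g(x, lo x)) dx` with the explicit base `D` and
graphs `lo`, `hi` of `setOf_hConstraints_eq_between_graphs`.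
[cite: EvansGariepy2015, Thm 5.16 (Gauss–Green), convex polyhedra, vertical component] -/
theorem setIntegral_deriv_hPolyhedron {J : Finset ι} {A : ι → (ℝ × ℝ) → ℝ}
    (hA : ∀ j, Continuous (A j)) (c b : ι → ℝ) (hup : (J.filter fun j => 0 < c j).Nonempty)
    (hlow : (J.filter fun j => c j < 0).Nonempty) {g g' : (ℝ × ℝ) × ℝ → ℝ}
    (hderiv : ∀ x t, HasDerivAt (fun s => g (x, s)) (g' (x, t)) t) (hcont : Continuous g')
    (hint : IntegrableOn g' {p : (ℝ × ℝ) × ℝ | ∀ j ∈ J, A j p.1 + c j * p.2 ≤ b j} volume) :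
    ∫ p in {p : (ℝ × ℝ) × ℝ | ∀ j ∈ J, A j p.1 + c j * p.2 ≤ b j}, g' p =
      ∫ x in {x : ℝ × ℝ | (∀ j ∈ J, c j = 0 → A j x ≤ b j) ∧
          (J.filter fun j => c j < 0).sup' hlow (fun j => (b j - A j x) / c j) ≤
            (J.filter fun j => 0 < c j).inf' hup (fun j => (b j - A j x) / c j)},
        (g (x, (J.filter fun j => 0 < c j).inf' hup (fun j => (b j - A j x) / c j)) -
          g (x, (J.filter fun j => c j < 0).sup' hlow (fun j => (b j - A j x) / c j))) := by
  rw [setOf_hConstraints_eq_between_graphs A c b hup hlow] at hint ⊢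
  refine setIntegral_deriv_between_graphs_volume
    (measurableSet_baseOfHConstraints hA c b hup hlow)
    (continuous_loGraph hA c b hlow).measurable (continuous_hiGraph hA c b hup).measurable
    (fun x hx => hx.2) (fun x _ t _ => hderiv x t) (fun x _ => ?_) hint
  exact (hcont.comp (Continuous.prodMk_right x)).continuousOn

end Literature.MeasureTheory.Integral

end
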